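import Mathlib
import Summits.Ventures.Crystal3D.Theorems.StickyWulffConstantLayerChainDefs
import HarnessLib

/-!
# Discrete calibration for the homogenised stacking tension (stub `stub_calibration` of the
# crux `StackingLiminf`, stmt-Ventures-19145, line `LayerChain`)

Route `StickyWulffConstant` of the venture `Summits/Ventures/Crystal3D` (cell `crystal3d-full`).
STEP 3(a) core of the planner's line `LayerChain` (cf-p1 gen 10, `LayerChain.lean` v3), stated
over the landed vocabulary `StickyWulffConstantLayerChainDefs` (p473239): for every letter density `f ∈ [0,1]` and every normal `n` there is a
unit-capacity bond flow — in-layer values `α`, `+`-gap values `βp`, `−`-gap values `βm`, all in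
`[-1,1]` — which is CONSERVED at every site whatever the order of the letters
(`∑ βp = ∑ βm`, Kirchhoff's law at a site between a `+` gap and a `−` gap), and whose flux
density attains the homogenised tension `stackTension f n = ⨅ τ, Φ_f(n, τ)`, where
`Φ_f(n,τ) = ∑ᵢ |n·aᵢ| + ∑ᵢ |(1−f) n·b⁺ᵢ + (1−f)f τ| + ∑ᵢ |f n·b⁻ᵢ − (1−f)f τ|` is the lifted cell
function of the line (`aᵢ` the in-plane bond vectors `(1,0,0), (½,√3/2,0), (−½,√3/2,0)`;
`b^±ᵢ = (±ℓᵢ, √(2/3))`, `ℓ₁ = (½,√3/6)`, `ℓ₂ = (−½,√3/6)`, `ℓ₃ = (0,−√3/3)`).  The closing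
statement `stub_calibration` is `Calibration` of `LayerChain.lean` v3 verbatim; the work is done
for three abstract families of reals (`calibration_of_families`), so nothing depends on the frame.

Mathematics: `τ ↦ Φ_f(n,τ)` is, for `0 < f < 1`, `(1−f)f` times a sum of six distances
`|τ − r_j|`; at a MEDIAN `τ*` of the six kinks (third order statistic, via `Tuple.sort`) at most
three kinks lie strictly on either side, so generalized signs `s_j ∈ [-1,1]` with
`s_j (τ* − r_j) = |τ* − r_j|` and `∑ s_j = 0` exist (`exists_balanced_signs_six`); they are the
gap values of the flow (`βp = s` on the `+` kinks, `βm = −s` on the `−` kinks), the balance is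
Kirchhoff's law, and `Φ_f(n,τ*)` equals the flux term by term.  For `f ∈ {0,1}` the cell function
is `τ`-free and the idle family of gap values is chosen constant to balance.  Weak duality
(flux `≤ Φ_f(n,τ)` for every `τ`) is `calibFlux_le_stackPhi` of the line file; so the flow is a
minimiser certificate.
WHAT THIS IS NOT: the chimera (Γ-liminf) step, slice domination, or any statement about
clusters; rung F-C1 not moved.
-/

noncomputable section

namespace Summit.Ventures.Crystal3D.Theorems

open Finset
open Summit.Ventures.Crystal3D.LayerChain

/-- The crude sign `x ↦ if 0 ≤ x then 1 else −1` recovers the absolute value. -/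
theorem ite_nonneg_mul_self_eq_abs (x : ℝ) : (if 0 ≤ x then (1 : ℝ) else -1) * x = |x| := by
  split_ifs with h
  · rw [abs_of_nonneg h, one_mul]
  · rw [abs_of_neg (not_le.1 h)]; ring

/-- The crude sign has absolute value at most one. -/
theorem abs_ite_nonneg_le_one (x : ℝ) : |(if 0 ≤ x then (1 : ℝ) else -1)| ≤ 1 := by
  split_ifs <;> simp

/-- **Balanced generalized signs at a median.** For six reals `r_j` there are a point `τ` and
numbers `s_j ∈ [-1,1]` with `s_j (τ − r_j) = |τ − r_j|` (so `s_j = ±1` off the ties) and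
`∑ s_j = 0`.  (`τ` = the third order statistic; the tie values absorb the imbalance, which is at
most the number of ties because at most three kinks lie strictly on either side.) -/
theorem exists_balanced_signs_six (r : Fin 6 → ℝ) :
    ∃ τ : ℝ, ∃ s : Fin 6 → ℝ, (∀ j, |s j| ≤ 1) ∧ (∀ j, s j * (τ - r j) = |τ - r j|) ∧
      ∑ j, s j = 0 := by
  classical
  set σ := Tuple.sort r with hσ
  have hmono : Monotone (r ∘ σ) := Tuple.monotone_sort r
  set τ : ℝ := r (σ 3) with hτ
  set L : ℝ := ∑ j : Fin 6, (if r j < τ then (1 : ℝ) else 0) with hL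
  set G : ℝ := ∑ j : Fin 6, (if τ < r j then (1 : ℝ) else 0) with hG
  set E : ℝ := ∑ j : Fin 6, (if r j = τ then (1 : ℝ) else 0) with hE
  have hLGE : L + G + E = 6 := by
    rw [hL, hG, hE, ← Finset.sum_add_distrib, ← Finset.sum_add_distrib]
    have h1 : ∀ j : Fin 6, ((if r j < τ then (1 : ℝ) else 0) + (if τ < r j then (1 : ℝ) else 0) +
        (if r j = τ then (1 : ℝ) else 0)) = 1 := by
      intro j
      rcases lt_trichotomy (r j) τ with h | h | h
      · simp [h, h.ne, not_lt.2 h.le]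
      · simp [h]
      · simp [h, h.ne', not_lt.2 h.le]
    simp_rw [h1]
    norm_num
  have hL0 : 0 ≤ L := Finset.sum_nonneg fun j _ => by split_ifs <;> norm_num
  have hG0 : 0 ≤ G := Finset.sum_nonneg fun j _ => by split_ifs <;> norm_num
  have hL3 : L ≤ 3 := by
    have e : L = ∑ i : Fin 6, (if r (σ i) < τ then (1 : ℝ) else 0) := by
      rw [hL]; exact (Equiv.sum_comp σ (fun j => if r j < τ then (1 : ℝ) else 0)).symm
    rw [e]
    have hle : ∀ i : Fin 6, (if r (σ i) < τ then (1 : ℝ) else 0) ≤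
        if (i : ℕ) < 3 then (1 : ℝ) else 0 := by
      intro i
      by_cases hi : (i : ℕ) < 3
      · rw [if_pos hi]; split_ifs <;> norm_num
      · have h3i : (3 : Fin 6) ≤ i := by
          rw [Fin.le_iff_val_le_val]; exact not_lt.1 hi
        have : τ ≤ r (σ i) := hmono h3i
        rw [if_neg hi, if_neg (not_lt.2 this)]
    calc _ ≤ ∑ i : Fin 6, (if (i : ℕ) < 3 then (1 : ℝ) else 0) :=
          Finset.sum_le_sum fun i _ => hle i
      _ = 3 := by rw [Finset.sum_boole]; norm_cast
  have hG3 : G ≤ 3 := by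
    have e : G = ∑ i : Fin 6, (if τ < r (σ i) then (1 : ℝ) else 0) := by
      rw [hG]; exact (Equiv.sum_comp σ (fun j => if τ < r j then (1 : ℝ) else 0)).symm
    rw [e]
    have hle : ∀ i : Fin 6, (if τ < r (σ i) then (1 : ℝ) else 0) ≤
        if 3 < (i : ℕ) then (1 : ℝ) else 0 := by
      intro i
      by_cases hi : 3 < (i : ℕ)
      · rw [if_pos hi]; split_ifs <;> norm_num
      · have hi3 : i ≤ (3 : Fin 6) := by
          rw [Fin.le_iff_val_le_val]; exact not_lt.1 hi
        have : r (σ i) ≤ τ := hmono hi3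
        rw [if_neg hi, if_neg (not_lt.2 this)]
    calc _ ≤ ∑ i : Fin 6, (if 3 < (i : ℕ) then (1 : ℝ) else 0) :=
          Finset.sum_le_sum fun i _ => hle i
      _ = 2 := by rw [Finset.sum_boole]; norm_cast
      _ ≤ 3 := by norm_num
  have hE1 : 1 ≤ E := by
    have h := Finset.single_le_sum (f := fun j => if r j = τ then (1 : ℝ) else 0)
      (fun j _ => by split_ifs <;> norm_num) (Finset.mem_univ (σ 3))
    rw [if_pos hτ.symm] at h
    rw [hE]; exact h
  have hEpos : 0 < E := by linarith
  -- the tie value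
  set t : ℝ := (G - L) / E with ht
  have ht1 : |t| ≤ 1 := by
    rw [ht, abs_div, abs_of_pos hEpos, div_le_one hEpos, abs_le]
    constructor <;> linarith
  refine ⟨τ, fun j => if r j < τ then 1 else if τ < r j then -1 else t, fun j => ?_,
    fun j => ?_, ?_⟩
  · -- bounds
    by_cases h1 : r j < τ
    · simp [h1]
    · by_cases h2 : τ < r j
      · simp [h1, h2]
      · simp [h1, h2, ht1]
  · -- sign identity
    show (if r j < τ then (1 : ℝ) else if τ < r j then -1 else t) * (τ - r j) = |τ - r j|
    by_cases h1 : r j < τ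
    · rw [if_pos h1, one_mul, abs_of_pos (sub_pos.2 h1)]
    · by_cases h2 : τ < r j
      · rw [if_neg h1, if_pos h2, abs_of_neg (sub_neg.2 h2)]; ring
      · have : r j = τ := le_antisymm (not_lt.1 h2) (not_lt.1 h1)
        rw [this, sub_self, abs_zero, mul_zero]
  · -- balance
    have hpt : ∀ j : Fin 6, (if r j < τ then (1 : ℝ) else if τ < r j then -1 else t) =
        (if r j < τ then (1 : ℝ) else 0) - (if τ < r j then (1 : ℝ) else 0) +
          t * (if r j = τ then (1 : ℝ) else 0) := by
      intro j
      rcases lt_trichotomy (r j) τ with h | h | h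
      · simp [h, h.ne, not_lt.2 h.le]
      · simp [h]
      · simp [h, h.ne', not_lt.2 h.le]
    simp_rw [hpt]
    rw [Finset.sum_add_distrib, Finset.sum_sub_distrib, ← Finset.mul_sum, ← hL, ← hG, ← hE, ht,
      div_mul_cancel₀ _ hEpos.ne']
    ring

/-- **Calibration, abstract form.** For `f ∈ [0,1]` and any three families of reals `A, P, M`
(the in-layer and the two gap families of dot products) there is a conserved unit-capacity flow
`(α, βp, βm)` whose flux is at least `⨅ τ, (∑|Aᵢ| + ∑|(1−f)Pᵢ + (1−f)f τ| + ∑|f Mᵢ − (1−f)f τ|)`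
(hence equal to it, by weak duality). -/
theorem calibration_of_families (f : ℝ) (hf0 : 0 ≤ f) (hf1 : f ≤ 1) (A P M : Fin 3 → ℝ) :
    ∃ α βp βm : Fin 3 → ℝ, (∀ i, |α i| ≤ 1) ∧ (∀ i, |βp i| ≤ 1) ∧ (∀ i, |βm i| ≤ 1) ∧
      (∑ i : Fin 3, βp i) = (∑ i : Fin 3, βm i) ∧
      (⨅ τ : ℝ, ((∑ i : Fin 3, |A i|) + (∑ i : Fin 3, |(1 - f) * P i + (1 - f) * f * τ|) +
          ∑ i : Fin 3, |f * M i - (1 - f) * f * τ|)) ≤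
        (∑ i : Fin 3, α i * A i) + (1 - f) * (∑ i : Fin 3, βp i * P i) +
          f * (∑ i : Fin 3, βm i * M i) := by
  classical
  set Φ : ℝ → ℝ := fun τ => (∑ i : Fin 3, |A i|) +
    (∑ i : Fin 3, |(1 - f) * P i + (1 - f) * f * τ|) + ∑ i : Fin 3, |f * M i - (1 - f) * f * τ|
    with hΦ
  have hB : BddBelow (Set.range Φ) := by
    refine ⟨0, ?_⟩
    rintro _ ⟨τ, rfl⟩
    simp only [hΦ]
    positivity
  have hinf : ∀ τ, (⨅ τ' : ℝ, Φ τ') ≤ Φ τ := fun τ => ciInf_le hB τ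
  -- the in-layer values
  set α : Fin 3 → ℝ := fun i => if 0 ≤ A i then 1 else -1 with hα
  have hαA : ∀ i, α i * A i = |A i| := fun i => ite_nonneg_mul_self_eq_abs (A i)
  have hαb : ∀ i, |α i| ≤ 1 := fun i => abs_ite_nonneg_le_one (A i)
  have hsumA : (∑ i : Fin 3, α i * A i) = ∑ i : Fin 3, |A i| :=
    Finset.sum_congr rfl fun i _ => hαA i
  rcases eq_or_lt_of_le hf0 with hf | hfpos
  · -- f = 0 : the cell function is `τ`-free
    subst hf
    set βp : Fin 3 → ℝ := fun i => if 0 ≤ P i then 1 else -1 with hβp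
    have hβP : ∀ i, βp i * P i = |P i| := fun i => ite_nonneg_mul_self_eq_abs (P i)
    have hβb : ∀ i, |βp i| ≤ 1 := fun i => abs_ite_nonneg_le_one (P i)
    have hS3 : |∑ i : Fin 3, βp i| ≤ 3 := by
      refine (Finset.abs_sum_le_sum_abs _ _).trans ?_
      calc (∑ i : Fin 3, |βp i|) ≤ ∑ _i : Fin 3, (1 : ℝ) := Finset.sum_le_sum fun i _ => hβb i
        _ = 3 := by simp
    refine ⟨α, βp, fun _ => (∑ i : Fin 3, βp i) / 3, hαb, hβb, fun _ => ?_, ?_, ?_⟩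
    · rw [abs_div, abs_of_pos (by norm_num : (0:ℝ) < 3), div_le_one (by norm_num)]
      exact hS3
    · simp only [Finset.sum_const, Finset.card_univ, Fintype.card_fin, nsmul_eq_mul]
      ring
    · refine (hinf 0).trans (le_of_eq ?_)
      simp only [hΦ, sub_zero, zero_mul, mul_zero, add_zero, one_mul, abs_zero,
        Finset.sum_const_zero, hsumA]
      rw [Finset.sum_congr rfl fun i _ => hβP i]
  rcases eq_or_lt_of_le hf1 with hf | hflt
  · -- f = 1 : symmetric
    subst hf
    set βm : Fin 3 → ℝ := fun i => if 0 ≤ M i then 1 else -1 with hβm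
    have hβM : ∀ i, βm i * M i = |M i| := fun i => ite_nonneg_mul_self_eq_abs (M i)
    have hβb : ∀ i, |βm i| ≤ 1 := fun i => abs_ite_nonneg_le_one (M i)
    have hS3 : |∑ i : Fin 3, βm i| ≤ 3 := by
      refine (Finset.abs_sum_le_sum_abs _ _).trans ?_
      calc (∑ i : Fin 3, |βm i|) ≤ ∑ _i : Fin 3, (1 : ℝ) := Finset.sum_le_sum fun i _ => hβb i
        _ = 3 := by simp
    refine ⟨α, fun _ => (∑ i : Fin 3, βm i) / 3, βm, hαb, fun _ => ?_, hβb, ?_, ?_⟩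
    · rw [abs_div, abs_of_pos (by norm_num : (0:ℝ) < 3), div_le_one (by norm_num)]
      exact hS3
    · simp only [Finset.sum_const, Finset.card_univ, Fintype.card_fin, nsmul_eq_mul]
      ring
    · refine (hinf 0).trans (le_of_eq ?_)
      simp only [hΦ, sub_self, zero_mul, add_zero, sub_zero, one_mul, abs_zero,
        Finset.sum_const_zero, hsumA]
      rw [Finset.sum_congr rfl fun i _ => hβM i]
  -- 0 < f < 1 : median of the six kinks
  have h1f : 0 < 1 - f := sub_pos.2 hflt
  have hc : 0 < (1 - f) * f := mul_pos h1f hfpos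
  set R : Fin 6 → ℝ := ![-(P 0) / f, -(P 1) / f, -(P 2) / f, M 0 / (1 - f), M 1 / (1 - f),
    M 2 / (1 - f)] with hR
  obtain ⟨τ, s, hs1, hsR, hs0⟩ := exists_balanced_signs_six R
  set βp : Fin 3 → ℝ := ![s 0, s 1, s 2] with hβp
  set βm : Fin 3 → ℝ := ![-s 3, -s 4, -s 5] with hβm
  -- the affine gap terms are `c (τ − R_j)` resp. `−c (τ − R_j)`
  have hP : ∀ i : Fin 3, (1 - f) * P i + (1 - f) * f * τ =
      (1 - f) * f * (τ - R (Fin.castAdd 3 i)) := by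
    intro i
    fin_cases i <;> simp [hR] <;> field_simp <;> ring
  have hM : ∀ i : Fin 3, f * M i - (1 - f) * f * τ =
      -((1 - f) * f * (τ - R (Fin.natAdd 3 i))) := by
    intro i
    fin_cases i <;> simp [hR] <;> field_simp <;> ring
  have hβpP : ∀ i : Fin 3, βp i * ((1 - f) * P i + (1 - f) * f * τ) =
      |(1 - f) * P i + (1 - f) * f * τ| := by
    intro i
    rw [hP i, abs_mul, abs_of_pos hc]
    have key := hsR (Fin.castAdd 3 i)
    fin_cases i <;> simp [hβp] at key ⊢ <;> nlinarith [key]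
  have hβmM : ∀ i : Fin 3, βm i * (f * M i - (1 - f) * f * τ) =
      |f * M i - (1 - f) * f * τ| := by
    intro i
    rw [hM i, abs_neg, abs_mul, abs_of_pos hc]
    have key := hsR (Fin.natAdd 3 i)
    fin_cases i <;> simp [hβm] at key ⊢ <;> nlinarith [key]
  have hbal : (∑ i : Fin 3, βp i) = ∑ i : Fin 3, βm i := by
    simp only [Fin.sum_univ_three, hβp, hβm, Matrix.cons_val_zero, Matrix.cons_val_one,
      Matrix.head_cons, Matrix.cons_val_two, Matrix.tail_cons]
    simp only [Fin.sum_univ_six] at hs0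
    linarith
  refine ⟨α, βp, βm, hαb, fun i => ?_, fun i => ?_, hbal, ?_⟩
  · fin_cases i <;> simp [hβp, hs1]
  · fin_cases i <;> simp [hβm, abs_neg, hs1]
  · refine (hinf τ).trans (le_of_eq ?_)
    simp only [hΦ]
    rw [hsumA, ← Finset.sum_congr rfl fun i _ => hβpP i, ← Finset.sum_congr rfl fun i _ => hβmM i]
    have hbal3 : βp 0 + βp 1 + βp 2 = βm 0 + βm 1 + βm 2 := by
      simpa only [Fin.sum_univ_three] using hbal
    simp only [Fin.sum_univ_three]
    have : (1 - f) * f * τ * (βp 0 + βp 1 + βp 2) = (1 - f) * f * τ * (βm 0 + βm 1 + βm 2) := by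
      rw [hbal3]
    linear_combination this

/-- **Stub `stub_calibration` (STEP 3(a) core of line `LayerChain`; statement = `Calibration` of
`LayerChain.lean` v3 verbatim, over the landed vocabulary `StickyWulffConstantLayerChainDefs`
(`stackTension`, `calibFlux`; p473239).**  For every letter density `f ∈ [0,1]` and normal `n`
there is a unit-capacity bond flow (`|αᵢ|, |βpᵢ|, |βmᵢ| ≤ 1`), conserved at every site whatever
the order of the letters (`∑ βp = ∑ βm`), whose flux density attains the homogenised stacking
tension `stackTension f n = ⨅ τ, Φ_f(n,τ)` (equality by the weak duality
`calibFlux_le_stackPhi`). -/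
theorem stub_calibration :
    ∀ f : ℝ, 0 ≤ f → f ≤ 1 → ∀ n : Fin 3 → ℝ,
      ∃ α βp βm : Fin 3 → ℝ, (∀ i, |α i| ≤ 1) ∧ (∀ i, |βp i| ≤ 1) ∧ (∀ i, |βm i| ≤ 1) ∧
        (∑ i : Fin 3, βp i) = (∑ i : Fin 3, βm i) ∧ stackTension f n ≤ calibFlux f n α βp βm := by
  intro f hf0 hf1 n
  obtain ⟨α, βp, βm, hα, hp, hm, hbal, hle⟩ := calibration_of_families f hf0 hf1
    (fun i => dot3 n (aVec i)) (fun i => dot3 n (bPlus i)) (fun i => dot3 n (bMinus i))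
  exact ⟨α, βp, βm, hα, hp, hm, hbal, by simpa only [stackTension, stackPhi, calibFlux] using hle⟩

/-- The calibration identifies the tension: `stackTension f n` IS the flux of the calibrating
flow (attainment + weak duality). -/
theorem exists_stackTension_eq_calibFlux (f : ℝ) (hf0 : 0 ≤ f) (hf1 : f ≤ 1) (n : Fin 3 → ℝ) :
    ∃ α βp βm : Fin 3 → ℝ, (∀ i, |α i| ≤ 1) ∧ (∀ i, |βp i| ≤ 1) ∧ (∀ i, |βm i| ≤ 1) ∧
      (∑ i : Fin 3, βp i) = (∑ i : Fin 3, βm i) ∧ stackTension f n = calibFlux f n α βp βm := by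
  obtain ⟨α, βp, βm, hα, hp, hm, hbal, hle⟩ := stub_calibration f hf0 hf1 n
  refine ⟨α, βp, βm, hα, hp, hm, hbal, le_antisymm hle ?_⟩
  have hB : BddBelow (Set.range fun τ : ℝ => stackPhi f n τ) :=
    ⟨calibFlux f n α βp βm, by
      rintro _ ⟨τ, rfl⟩; exact calibFlux_le_stackPhi f n α βp βm hα hp hm hbal τ⟩
  exact le_ciInf fun τ => calibFlux_le_stackPhi f n α βp βm hα hp hm hbal τ

end Summit.Ventures.Crystal3D.Theorems

end
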